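import Literature.MathematicalPhysics.QuantumFieldTheory.Balaban1983to89.B14Sect3
import Literature.MathematicalPhysics.QuantumFieldTheory.Balaban1983to89.B15Claim192Flow

/-!
# `T4Continuum.Spine.NE7c.LiveFactorCrossLevel` — spine estimate NE7c (node U5b), road (δ) THRESHOLD RANDOMISATION:
# the CROSS-LEVEL rows of the robustness census under LEVEL-DEPENDENT live factors (input (L1-levelwise) of members
# (δ-global) ∕ (δ-global-compact)) in kernel form — the printed chains [B14] (3.8) and [B15] p. 192 consumed BY NAME
# (cell `pub-balaban-gaps`, track G2, seat ne8 gen 8; record `HOME/ne/NE7c.md` §14 PRICE (ii), §15)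

HONEST FRAMING.  Finite four-torus programme, rung (B)+1 only — NOT infinite volume, NOT a mass gap, NOT the Clay
problem, NOT summit progress, NOT a proof of NE7c (INSTANCE 0∕1, node O).  Nothing of [Bałaban 1983–89] is asserted:
the manuscripts fix their thresholds ONCE and never vary them; the printed displays enter only through the tree's
as-printed leaves (`B14Sect3.ineq38_scalar` — [B14] (3.8) p. 266; `B15Claim192Flow.deltaPrime_chain4` — [B15] p. 192),
and everything else is elementary real arithmetic.  No `def`, 0 sorry.  Spine PROVED 0∕9 — unchanged by this file.

THE QUESTION (seat census `HOME/ne/NE7c.md` §14 PRICE (ii)).  Member (δ-1) of road (δ) multiplies EVERY live threshold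
by ONE common factor `λ ∈ [λ₀, 1]`, so every printed relation BETWEEN thresholds of different levels is exactly
invariant (homogeneity) and the robustness input is (L1-step).  Members (δ-global) (`LiveFactorGlobalLevels`, gen 7) and
(δ-global-compact) (`LiveFactorGlobalCompact`, gen 8) give EACH LEVEL `j` its own factor `μ_j ∈ [λ₀, 1]`, unordered; the
input becomes (L1-levelwise) = (L1-step) ∪ {the census's CROSS-LEVEL rows 10, 13, 22, 23-edge, 28-(3.8), 41}, where a
ratio `μ_i/μ_j ≤ λ₀⁻¹` may enter.  The gen-7 tally classed all six MILD by reading.  THIS FILE types the mechanism: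
(§1) the three generic patterns — a threshold on the SMALL side of a printed comparison only gains (`smallSide_live`),
thresholds on BOTH sides cost the ratio `λ₀⁻¹` on the printed constant (`bothSides_live`), and a printed FREE constant
`α` («can be made arbitrarily small by choosing γ, or A₁∕A₀ sufficiently small», [B15] p. 186; «α = 1∕12», p. 198)
absorbs it when chosen as `α·λ₀` (`freeConstant_live`) — rows 10, 22, 23-edge, 41; (§2) the ONE row with a located
numerical constraint, [B14] (3.8) (census row 28): the printed three-member chain `|U_{k,□}(∂p) − 1| < (1 + (2∕10)ε_kη)
ε_{k+1}(L⁻¹η)² + (2∕10)ε_kη²(1 + (4∕10)ε_k) < 2(1+β₀)L⁻²ε_kη² + (4∕10)ε_kη² < ε_kη²` has the level-`(k+1)` regularity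
THRESHOLD `ε_{k+1}(L⁻¹η)²` ((3.2)) inside its first member and the level-`k` threshold `ε_kη²` (the inherited test
`χ_k`) as its target; at live letters (factor `μ′` on the level-`(k+1)` threshold, `ν ≤ 1` on the analytic bound (3.7)
`|𝐇| < ε_k∕10` — an upper use —, target factor `μ`) the chain closes iff `2(1+β₀)L⁻²μ′ + (4∕10)ν < μ`
(`ineq38_live`, from `B14Sect3.ineq38_scalar` BY NAME): under ONE common factor this IS print's restriction
`2(1+β₀)L⁻² + 4∕10 < 1` times `λ` (`ineq38_live_common` — the census's «homogeneous, invariant» for (δ-1), kernel), equally under factors ORDERED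
along the step, younger ≤ older (`ineq38_live_ordered`), while under unordered level-wise factors it is implied by
print's restriction WITH ROOM `λ₀`: `2(1+β₀)L⁻² + 4∕10 < λ₀`
(`ineq38_live_levelwise`) — the located numerical constraint of §14, exactly; it holds e.g. for `L ≥ 3`, `β₀ ≤ 1∕2`,
`λ₀ ≥ 3∕4` (`levelwise_room_L3`), and at `L = 2` iff `β₀ < 2λ₀ − 9∕5` (`levelwise_room_L2_iff`); (§3) [B15] p. 192's
cumulation `N₀δ′_j < 4N₀²δ′_k` (census row 13) along the typed [III] flow: with the level-`j` factor on the small side it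
holds verbatim (`deltaPrime_chain4_live`, `B15Claim192Flow.deltaPrime_chain4` BY NAME), and against the LIVE `δ′_k` with
the constant `4∕λ₀` (`deltaPrime_chain4_live_ratio`).

NET for the census: of the six cross-level rows, five are instances of §1 (free constant or ratio on a size constant —
no constraint), and row 28-(3.8) carries the one constraint `2(1+β₀)L⁻² + 4∕10 < λ₀` (none beyond print's for `L ≥ 3`,
`β₀ ≤ 1∕2`, `β′ = 1 − λ₀ ≤ 1∕4`).  NOT HERE: the located READING that these are all the cross-level threshold relations of
[B14]–[B16] (the census itself, two readers, `HOME/ne/NE7c.md` §7∕§9.1∕§11.1∕§14); node O; NE7c NOT proved.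
-/

namespace Summit.QuantumFields.BalabanUV.T4Continuum.Spine.NE7c.LiveFactorCrossLevel

open Literature.MathematicalPhysics.QuantumFieldTheory.Balaban1983to89

/-! ## §1 The three generic patterns of a printed cross-level comparison under level-wise live factors -/

/-- PATTERN 1 (threshold on the SMALL side only — census rows 13, 22 left-hand sides, every «new (scaled) ⇒ inherited
(unscaled)» implication): a printed `x ≤ y` with the level factor `μ ≤ 1` on `x ≥ 0` holds a fortiori. [folklore] -/
theorem smallSide_live {x y μ : ℝ} (hx : 0 ≤ x) (hμ1 : μ ≤ 1) (h : x ≤ y) : μ * x ≤ y :=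
  (mul_le_of_le_one_left hx hμ1).trans h

/-- PATTERN 2 (thresholds on BOTH sides — census rows 13 (against the live `δ′_k`), 41 ([B16] p. 362 `ε_h ≤
(1+β₀)²N^{β₀}ε_k`)): a printed `x ≤ C·y` between thresholds of two levels survives level factors `μ_i ≤ 1` (small
side), `μ_j ≥ λ₀ > 0` (large side) with the constant `C∕λ₀`. [folklore] -/
theorem bothSides_live {x y C μi μj lam0 : ℝ} (hx : 0 ≤ x) (hy : 0 ≤ y) (hC : 0 ≤ C) (hlam0 : 0 < lam0)
    (hμi1 : μi ≤ 1) (hμj : lam0 ≤ μj) (h : x ≤ C * y) : μi * x ≤ (C / lam0) * (μj * y) := by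
  have h1 : μi * x ≤ C * y := smallSide_live hx hμi1 h
  have h2 : C * y ≤ (C / lam0) * (μj * y) := by
    rw [div_mul_eq_mul_div, le_div_iff₀ hlam0]
    calc C * y * lam0 = C * (lam0 * y) := by ring
      _ ≤ C * (μj * y) := mul_le_mul_of_nonneg_left (mul_le_mul_of_nonneg_right hμj hy) hC
  exact h1.trans h2

/-- PATTERN 3 (a printed FREE constant absorbs the ratio — census rows 10 ([B15] (1.46)–(1.52): «can be made arbitrarily
small by choosing γ, or A₁∕A₀ sufficiently small … Let us choose a bound for these two factors in the form αβ»), 22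
((1.94) «< αε_h», «We have chosen α = 1∕12»), 23 at the window's edge («taking α ≤ 1∕8»)): if print's smallness is
invoked with the free constant `α·λ₀` instead of `α` — legitimate, `α·λ₀` is again an absolute constant once `λ₀` is —
i.e. `x ≤ (α·λ₀)·y`, then at live letters `μ_i·x ≤ α·(μ_j·y)` for any `μ_i ≤ 1`, `μ_j ≥ λ₀`. [folklore] -/
theorem freeConstant_live {x y α μi μj lam0 : ℝ} (hx : 0 ≤ x) (hy : 0 ≤ y) (hα : 0 ≤ α) (hlam0 : 0 < lam0)
    (hμi1 : μi ≤ 1) (hμj : lam0 ≤ μj) (h : x ≤ (α * lam0) * y) : μi * x ≤ α * (μj * y) := by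
  have h1 := bothSides_live hx hy (mul_nonneg hα hlam0.le) hlam0 hμi1 hμj h
  rwa [mul_div_assoc, div_self hlam0.ne', mul_one] at h1

/-! ## §2 Census row 28: [B14] (3.8) at live letters (the one located numerical constraint) -/

/-- **(3.8) AT LIVE LETTERS** ([B14] p. 266, `B14Sect3.Ineq38Printed` ∕ `ineq38_scalar` BY NAME).  Print: from the
level-`(k+1)` restriction `|U_{k+1,□′}(∂p) − 1| < ε_{k+1}(L⁻¹η)²` ((3.2)) and the bound (3.7) `|𝐇_{k,□}| < ε_k∕10`, the
chain `|U_{k,□}(∂p) − 1| < (1 + (2∕10)ε_kη)ε_{k+1}(L⁻¹η)² + (2∕10)ε_kη²(1 + (4∕10)ε_k) < 2(1+β₀)L⁻²ε_kη² + (4∕10)ε_kη² <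
ε_kη²` under `ε_{k+1} ≤ (1+β₀)ε_k` ((2.8)) and the restriction `2(1+β₀)L⁻² + 4∕10 < 1`, whence «χ_k(□) = 1».  LIVE: the
level-`(k+1)` threshold carries a factor `μ′ > 0`, the analytic bound (3.7) a factor `ν ∈ ]0, 1]` (an UPPER use: a
smaller threshold keeps `|𝐇| < ν·ε_k∕10 ≤ ε_k∕10`), the target (the inherited level-`k` test) a factor `μ`; the first
member at live letters is print's with `ε_{k+1} ↦ μ′ε_{k+1}` and `ε_k ↦ νε_k` in the (3.7)-slots.  THEN
`|U_{k,□}(∂p) − 1| < μ·ε_kη²` as soon as `2(1+β₀)L⁻²μ′ + (4∕10)ν < μ`. [folklore] -/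
theorem ineq38_live (u ε ε' η L β₀ μ μ' ν : ℝ) (hε : 0 < ε) (hε1 : ε ≤ 1) (hη : 0 < η) (hη1 : η ≤ 1) (hL : 0 < L)
    (hε' : 0 < ε') (hflow : ε' ≤ (1 + β₀) * ε) (hν0 : 0 < ν) (hν1 : ν ≤ 1) (hμ'0 : 0 < μ')
    (hrestr : 2 * (1 + β₀) * L⁻¹ ^ 2 * μ' + 4/10 * ν < μ)
    (hfirst : u < (1 + (2/10) * (ν * ε) * η) * (μ' * ε') * (L⁻¹ * η) ^ 2
      + (2/10) * (ν * ε) * η ^ 2 * (1 + (4/10) * (ν * ε))) :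
    u < μ * (ε * η ^ 2) := by
  -- print's scalar chain at the letters `ε ↦ νε`, `ε' ↦ μ'ε'`, `1 + β₀ ↦ (1 + β₀)μ'/ν`
  have hνε : 0 < ν * ε := mul_pos hν0 hε
  have hνε1 : ν * ε ≤ 1 := by nlinarith
  have hμ'ε' : 0 < μ' * ε' := mul_pos hμ'0 hε'
  have hflow' : μ' * ε' ≤ (1 + ((1 + β₀) * μ' / ν - 1)) * (ν * ε) := by
    have h1 : (1 + ((1 + β₀) * μ' / ν - 1)) * (ν * ε) = (1 + β₀) * μ' * ε := by
      field_simp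
      ring
    rw [h1]
    calc μ' * ε' ≤ μ' * ((1 + β₀) * ε) := mul_le_mul_of_nonneg_left hflow hμ'0.le
      _ = (1 + β₀) * μ' * ε := by ring
  have hchain := (B14Sect3.ineq38_scalar (ν * ε) (μ' * ε') η L ((1 + β₀) * μ' / ν - 1) hνε hνε1 hη hη1 hL hμ'ε'
    hflow').1
  have h2 : 2 * (1 + ((1 + β₀) * μ' / ν - 1)) * L⁻¹ ^ 2 * (ν * ε) * η ^ 2 + 4/10 * (ν * ε) * η ^ 2
      = (2 * (1 + β₀) * L⁻¹ ^ 2 * μ' + 4/10 * ν) * (ε * η ^ 2) := by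
    field_simp
    ring
  rw [h2] at hchain
  have hεη : 0 < ε * η ^ 2 := by positivity
  exact (hfirst.trans hchain).trans (mul_lt_mul_of_pos_right hrestr hεη)

/-- **MEMBER (δ-1): EXACT INVARIANCE.**  With ONE common factor `λ ∈ ]0, 1]` on all three letters (`μ = μ′ = ν = λ`)
the live chain closes under PRINT's restriction `2(1+β₀)L⁻² + 4∕10 < 1` verbatim (homogeneity: the restriction times
`λ`) — the census's class for row 28 under (δ-1), kernel-checked. [folklore] -/
theorem ineq38_live_common (u ε ε' η L β₀ lam : ℝ) (hε : 0 < ε) (hε1 : ε ≤ 1) (hη : 0 < η) (hη1 : η ≤ 1)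
    (hL : 0 < L) (hε' : 0 < ε') (hflow : ε' ≤ (1 + β₀) * ε) (hlam0 : 0 < lam) (hlam1 : lam ≤ 1)
    (hrestr : 2 * (1 + β₀) * L⁻¹ ^ 2 + 4/10 < 1)
    (hfirst : u < (1 + (2/10) * (lam * ε) * η) * (lam * ε') * (L⁻¹ * η) ^ 2
      + (2/10) * (lam * ε) * η ^ 2 * (1 + (4/10) * (lam * ε))) :
    u < lam * (ε * η ^ 2) := by
  refine ineq38_live u ε ε' η L β₀ lam lam lam hε hε1 hη hη1 hL hε' hflow hlam0 hlam1 hlam0 ?_ hfirst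
  have h : (2 * (1 + β₀) * L⁻¹ ^ 2 + 4/10) * lam < 1 * lam := mul_lt_mul_of_pos_right hrestr hlam0
  linarith

/-- **ORDERED FACTORS: EXACT INVARIANCE AGAIN.**  If the factors are ORDERED along the step — the younger level's factor
not above the older's, `μ′ ≤ μ`, and the (3.7)-bound's `ν ≤ μ` (it is fed by restrictions of levels `k`, `k+1`) — the
live chain closes under PRINT's restriction verbatim, as under one common factor (member (δ-stages)' ordered windows
give exactly this ordering inside a comparison). [folklore] -/
theorem ineq38_live_ordered (u ε ε' η L β₀ μ μ' ν : ℝ) (hε : 0 < ε) (hε1 : ε ≤ 1) (hη : 0 < η) (hη1 : η ≤ 1)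
    (hL : 0 < L) (hε' : 0 < ε') (hflow : ε' ≤ (1 + β₀) * ε) (hβ₀ : 0 ≤ 1 + β₀) (hν0 : 0 < ν) (hμ'0 : 0 < μ')
    (hμ1 : μ ≤ 1) (hμ'μ : μ' ≤ μ) (hνμ : ν ≤ μ) (hrestr : 2 * (1 + β₀) * L⁻¹ ^ 2 + 4/10 < 1)
    (hfirst : u < (1 + (2/10) * (ν * ε) * η) * (μ' * ε') * (L⁻¹ * η) ^ 2
      + (2/10) * (ν * ε) * η ^ 2 * (1 + (4/10) * (ν * ε))) :
    u < μ * (ε * η ^ 2) := by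
  have hμ0 : 0 < μ := hμ'0.trans_le hμ'μ
  refine ineq38_live u ε ε' η L β₀ μ μ' ν hε hε1 hη hη1 hL hε' hflow hν0 (hνμ.trans hμ1) hμ'0 ?_ hfirst
  have hA : 0 ≤ 2 * (1 + β₀) * L⁻¹ ^ 2 := by positivity
  have h1 : 2 * (1 + β₀) * L⁻¹ ^ 2 * μ' ≤ 2 * (1 + β₀) * L⁻¹ ^ 2 * μ := mul_le_mul_of_nonneg_left hμ'μ hA
  have h2 : 4/10 * ν ≤ 4/10 * μ := by linarith
  have h3 : (2 * (1 + β₀) * L⁻¹ ^ 2 + 4/10) * μ < 1 * μ := mul_lt_mul_of_pos_right hrestr hμ0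
  linarith

/-- **MEMBERS (δ-global) ∕ (δ-global-compact): PRINT's RESTRICTION WITH ROOM `λ₀`.**  With level-wise factors — `μ′ ≤ 1`
on the level-`(k+1)` threshold, `ν ≤ 1` on the (3.7)-bound, `μ ≥ λ₀` on the level-`k` target — the live chain closes
under `2(1+β₀)L⁻² + 4∕10 < λ₀`: the located numerical constraint of the (L1-levelwise) tally (`HOME/ne/NE7c.md` §14,
row 28-(3.8)), exactly. [folklore] -/
theorem ineq38_live_levelwise (u ε ε' η L β₀ μ μ' ν lam0 : ℝ) (hε : 0 < ε) (hε1 : ε ≤ 1) (hη : 0 < η)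
    (hη1 : η ≤ 1) (hL : 0 < L) (hε' : 0 < ε') (hflow : ε' ≤ (1 + β₀) * ε) (hβ₀ : 0 ≤ 1 + β₀) (hν0 : 0 < ν)
    (hν1 : ν ≤ 1) (hμ'0 : 0 < μ') (hμ'1 : μ' ≤ 1) (hμ : lam0 ≤ μ)
    (hrestr : 2 * (1 + β₀) * L⁻¹ ^ 2 + 4/10 < lam0)
    (hfirst : u < (1 + (2/10) * (ν * ε) * η) * (μ' * ε') * (L⁻¹ * η) ^ 2
      + (2/10) * (ν * ε) * η ^ 2 * (1 + (4/10) * (ν * ε))) :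
    u < μ * (ε * η ^ 2) := by
  refine ineq38_live u ε ε' η L β₀ μ μ' ν hε hε1 hη hη1 hL hε' hflow hν0 hν1 hμ'0 ?_ hfirst
  have hA : 0 ≤ 2 * (1 + β₀) * L⁻¹ ^ 2 := by positivity
  have h1 : 2 * (1 + β₀) * L⁻¹ ^ 2 * μ' ≤ 2 * (1 + β₀) * L⁻¹ ^ 2 := mul_le_of_le_one_right hA hμ'1
  have h2 : 4/10 * ν ≤ 4/10 := by linarith
  linarith

/-- THE ROOM IS FREE FOR `L ≥ 3`: with `β₀ ≤ 1∕2` (print: «β₀ > 0 can be chosen arbitrarily small», [B14] (2.6)) and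
`λ₀ ≥ 3∕4` (slack `β′ = 1 − λ₀ ≤ 1∕4`), `2(1+β₀)L⁻² + 4∕10 ≤ 1∕3 + 4∕10 < 3∕4 ≤ λ₀`. [folklore] -/
theorem levelwise_room_L3 {L β₀ lam0 : ℝ} (hL : 3 ≤ L) (hβ₀ : β₀ ≤ 1/2) (hlam0 : 3/4 ≤ lam0) :
    2 * (1 + β₀) * L⁻¹ ^ 2 + 4/10 < lam0 := by
  have hL0 : 0 < L := by linarith
  have hLi : L⁻¹ ≤ 1/3 := by rw [inv_le_comm₀ hL0 (by norm_num)]; linarith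
  have hLi0 : 0 ≤ L⁻¹ := inv_nonneg.mpr hL0.le
  have hsq : L⁻¹ ^ 2 ≤ 1/9 := by nlinarith
  have h1 : 2 * (1 + β₀) * L⁻¹ ^ 2 ≤ 2 * (3/2) * (1/9) := by
    have : 2 * (1 + β₀) ≤ 2 * (3/2) := by linarith
    exact mul_le_mul this hsq (by positivity) (by norm_num)
  linarith

/-- … while at `L = 2` the room is the located constraint `β₀ < 2λ₀ − 9∕5` (e.g. `β₀ < 1∕10` at `λ₀ = 19∕20`; print itself
needs `β₀ < 1∕5` there). [folklore] -/
theorem levelwise_room_L2_iff {β₀ lam0 : ℝ} :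
    2 * (1 + β₀) * (2 : ℝ)⁻¹ ^ 2 + 4/10 < lam0 ↔ β₀ < 2 * lam0 - 9/5 := by
  constructor <;> intro h <;> nlinarith [h]

/-! ## §3 Census row 13: [B15] p. 192's cumulation `N₀δ′_j < 4N₀²δ′_k` at live letters, along the typed [III] flow -/

section AlongFlow

open B15.BasicStep B15.Ineq194Flow B14FlowStep

variable (F : Flow) (K : ℕ) {γ β' β₀ : ℝ} {L p₁ : ℕ}

/-- **p. 192 AT LIVE LETTERS, SMALL SIDE** (`B15Claim192Flow.deltaPrime_chain4` BY NAME + pattern 1): along a flow of the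
[III] setting, for `j < k ≤ K`, `k − j ≤ N₀`, `N₀ ≥ 1`, `β₀ ≤ 1∕2`, the live level-`j` letter `μ_j·δ′_j` (`μ_j ≤ 1`)
obeys print's `N₀·(μ_jδ′_j) < 4N₀²·δ′_k` with print's constant — the right-hand side being print's SIZE constant (p. 192:
«we assume that N₀² makes only a logarithmic contribution to δ′_k»), no ratio enters. [folklore] -/
theorem deltaPrime_chain4_live (S : SmallnessFor γ β' β₀ L p₁) {A₁ : ℝ} (hA₁ : 0 < A₁) (hβ₀ : β₀ ≤ 1 / 2)
    (hrg : F.SatisfiesRG K) (hI : F.InInterval γ K) (hub : ∀ j, j < K → F.β (j + 1) (F.g j) ≤ β')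
    (hlb : ∀ j, j < K → 0 ≤ F.β (j + 1) (F.g j)) {j k N₀ : ℕ} (hjk : j < k) (hkK : k ≤ K) (hN : k - j ≤ N₀)
    (hN1 : 1 ≤ N₀) {μj : ℝ} (hμj1 : μj ≤ 1) :
    (N₀ : ℝ) * (μj * deltaPrimeK A₁ p₁ F j) < 4 * (N₀ : ℝ) ^ 2 * deltaPrimeK A₁ p₁ F k := by
  have h4 := B15Claim192Flow.deltaPrime_chain4 F K S hA₁ hβ₀ hrg hI hub hlb hjk hkK hN hN1
  have hδj : 0 ≤ deltaPrimeK A₁ p₁ F j :=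
    B15Claim192Flow.deltaPrimeK_nonneg F K S hA₁.le hI (hjk.le.trans hkK)
  have hN0 : (0 : ℝ) ≤ N₀ := Nat.cast_nonneg _
  calc (N₀ : ℝ) * (μj * deltaPrimeK A₁ p₁ F j) = μj * ((N₀ : ℝ) * deltaPrimeK A₁ p₁ F j) := by ring
    _ ≤ (N₀ : ℝ) * deltaPrimeK A₁ p₁ F j :=
        mul_le_of_le_one_left (mul_nonneg hN0 hδj) hμj1
    _ < 4 * (N₀ : ℝ) ^ 2 * deltaPrimeK A₁ p₁ F k := h4

/-- **p. 192 AT LIVE LETTERS, AGAINST THE LIVE `δ′_k`** (pattern 2): if the right-hand side is wanted in units of the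
live level-`k` letter `μ_k·δ′_k`, `μ_k ≥ λ₀ > 0`, the printed constant `4` becomes `4∕λ₀` (`≤ 16∕3` for `β′ ≤ 1∕4`) —
still «only a logarithmic contribution». [folklore] -/
theorem deltaPrime_chain4_live_ratio (S : SmallnessFor γ β' β₀ L p₁) {A₁ : ℝ} (hA₁ : 0 < A₁) (hβ₀ : β₀ ≤ 1 / 2)
    (hrg : F.SatisfiesRG K) (hI : F.InInterval γ K) (hub : ∀ j, j < K → F.β (j + 1) (F.g j) ≤ β')
    (hlb : ∀ j, j < K → 0 ≤ F.β (j + 1) (F.g j)) {j k N₀ : ℕ} (hjk : j < k) (hkK : k ≤ K) (hN : k - j ≤ N₀)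
    (hN1 : 1 ≤ N₀) {μj μk lam0 : ℝ} (hμj1 : μj ≤ 1) (hlam0 : 0 < lam0) (hμk : lam0 ≤ μk) :
    (N₀ : ℝ) * (μj * deltaPrimeK A₁ p₁ F j) < (4 / lam0) * (N₀ : ℝ) ^ 2 * (μk * deltaPrimeK A₁ p₁ F k) := by
  have h := deltaPrime_chain4_live F K S hA₁ hβ₀ hrg hI hub hlb hjk hkK hN hN1 hμj1
  have hδk : 0 ≤ deltaPrimeK A₁ p₁ F k := B15Claim192Flow.deltaPrimeK_nonneg F K S hA₁.le hI hkK
  have hN0 : (0 : ℝ) ≤ (N₀ : ℝ) ^ 2 := by positivity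
  have h2 : 4 * (N₀ : ℝ) ^ 2 * deltaPrimeK A₁ p₁ F k ≤ (4 / lam0) * (N₀ : ℝ) ^ 2 * (μk * deltaPrimeK A₁ p₁ F k) := by
    rw [show (4 / lam0) * (N₀ : ℝ) ^ 2 * (μk * deltaPrimeK A₁ p₁ F k)
        = (4 * (N₀ : ℝ) ^ 2 * deltaPrimeK A₁ p₁ F k) * (μk / lam0) by field_simp]
    have hq : 1 ≤ μk / lam0 := by rw [le_div_iff₀ hlam0, one_mul]; exact hμk
    have hP : 0 ≤ 4 * (N₀ : ℝ) ^ 2 * deltaPrimeK A₁ p₁ F k := by positivity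
    exact le_mul_of_one_le_right hP hq
  exact h.trans_le h2

end AlongFlow

end Summit.QuantumFields.BalabanUV.T4Continuum.Spine.NE7c.LiveFactorCrossLevel
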